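import Literature.NumberTheory.LFunctions.FordIncompleteS4Count
import HarnessLib

/-!
# Ford's Lemma 4.1, case `S₄`: the count `W(q)`

Topic `Literature/NumberTheory/LFunctions`. Everything here is PROVED.

`W(q)` is the number of solutions of Ford's (4.7): heads `x, y ∈ ℬ^t` (injective, `(q, J*(x)J*(y)) = 1`),
`u, v ∈ 𝒞(P/q, R)^m`, `∑_{i≤t}(x_i^j − y_i^j) + q^j ∑_{i≤m}(u_i^j − v_i^j) = 0` (`h ≤ j ≤ k`).
By Proposition ZRD the number of `(u, v)` for fixed `(x, y)` is at most `J_{m,k,h}(𝒞(P/q,R))`, and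
it is zero unless `q^j ∣ ∑ (x_i^j − y_i^j)`; the number of such `(x, y)` is at most
`|ℬ|^t (k^t)^{ω(q)}` (`FordVK.card_cong_le`). Hence
`W(q) ≤ |ℬ|^t (k^t)^{N₁} J_{m,k,h}(𝒞(P/q,R))` (`FordVK.Wcount_le`).

## References

* K. Ford, Proc. London Math. Soc. (3) 85 (2002), 565–633, proof of Lemma 4.1 (case S₄, (4.7) and
  the following paragraph). [Ford2002]
-/

noncomputable section

open Finset

namespace Literature.NumberTheory.LFunctions
namespace FordVK

open VMV FordSmooth

/-! ### Scaling of frequencies by `q^j` -/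

/-- `scale q w = (q^{j} w_j)_j` (coordinate `j : Fin k` ↔ exponent `j+1`). [folklore] -/
def scale {k : ℕ} (q : ℤ) (w : Fin k → ℤ) : Fin k → ℤ := fun j => q ^ (j.val + 1) * w j

/-- `ν(q u) = scale q (ν u)`. [folklore] -/
theorem nuR_mul_left {k h g : ℕ} (q u : ℤ) : nuR k h g (q * u) = scale q (nuR k h g u) := by
  funext j
  simp only [nuR, scale]
  split_ifs
  · rw [mul_pow]
  · rw [mul_zero]

/-- `scale` is additive. [folklore] -/
theorem scale_add {k : ℕ} (q : ℤ) (a b : Fin k → ℤ) : scale q (a + b) = scale q a + scale q b := by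
  funext j; simp [scale, mul_add]

/-- `scale` of a finite sum. [folklore] -/
theorem scale_sum {k : ℕ} {ι : Type*} (q : ℤ) (s : Finset ι) (a : ι → Fin k → ℤ) :
    scale q (∑ i ∈ s, a i) = ∑ i ∈ s, scale q (a i) := by
  classical
  induction s using Finset.induction_on with
  | empty => funext j; simp [scale]
  | insert i s hi ih => rw [sum_insert hi, sum_insert hi, scale_add, ih]

/-- `∑_i ν(q u_i) = scale q (s(u))`. [folklore] -/
theorem sum_nuR_mul_eq_scale {k h g m : ℕ} (q : ℤ) (u : Fin m → ℤ) :
    ∑ i, nuR k h g (q * u i) = scale q (psvR k h g u) := by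
  rw [psvR_eq_sum_nuR, scale_sum]
  exact sum_congr rfl fun i _ => nuR_mul_left q (u i)

/-- Cancelling `q^{j}` coordinatewise. [folklore] -/
theorem eq_of_scale_eq {k : ℕ} {q : ℤ} (hq : q ≠ 0) {a b : Fin k → ℤ} (h : scale q a = scale q b) :
    a = b := by
  funext j
  have := congr_fun h j
  simp only [scale] at this
  exact mul_left_cancel₀ (pow_ne_zero _ hq) this

/-! ### `W(q)` -/

section W

variable (k h t m : ℕ) (B : Finset ℤ) (q : ℕ) (Bq : Finset ℤ)

/-- Injective heads coprime to `q` (in the sense `(q, J*(x)) = 1`). [cite: Ford2002, (4.7)] -/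
def X1 : Finset (Fin t → ℤ) := (tuplesInj t B).filter fun x => Nat.Coprime q (JN x)

/-- `W(q)`: the number of solutions of (4.7) (with `g = k`). [cite: Ford2002, (4.7)] -/
def Wcount : ℕ :=
  (((X1 t B q ×ˢ tuples m Bq) ×ˢ (X1 t B q ×ˢ tuples m Bq)).filter fun p =>
    psvR k h k p.1.1 + scale (q : ℤ) (psvR k h k p.1.2)
      = psvR k h k p.2.1 + scale (q : ℤ) (psvR k h k p.2.2)).card

variable {k h t m B q Bq}

/-- **The `(u, v)`-fibre over `(x, y)`**: empty unless `q^j ∣ s(y)_j − s(x)_j` for all `j`, and then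
of size `≤ J_{m,k,h}(ℬ_q)` by Proposition ZRD. [cite: Ford2002, proof of Lemma 4.1 ("by Proposition
ZRD, for each possible 2t-tuple x, y in (4.7), the number of u, v is at most J_{s-t,k,h}(𝒞(P/q,R))")] -/
theorem card_uv_fiber_le (hq : q ≠ 0) (x y : Fin t → ℤ) :
    ((tuples m Bq ×ˢ tuples m Bq).filter fun uv =>
        psvR k h k x + scale (q : ℤ) (psvR k h k uv.1) = psvR k h k y + scale (q : ℤ) (psvR k h k uv.2)).card
      ≤ if ∀ j : Fin k, ((q : ℤ) ^ (j.val + 1)) ∣ psvR k h k y j - psvR k h k x j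
          then Jinc k m Bq h k else 0 := by
  classical
  have hqZ : (q : ℤ) ≠ 0 := by exact_mod_cast hq
  split_ifs with hdiv
  · -- the target vector `w`
    set w : Fin k → ℤ := fun j => (psvR k h k y j - psvR k h k x j) / (q : ℤ) ^ (j.val + 1) with hw
    have hw' : scale (q : ℤ) w = psvR k h k y - psvR k h k x := by
      funext j
      simp only [scale, hw, Pi.sub_apply]
      rw [mul_comm]
      exact Int.ediv_mul_cancel (hdiv j)
    refine le_trans (card_le_card fun uv huv => ?_) (zrd (tuples m Bq) (psvR k h k) w)
    rw [mem_filter] at huv ⊢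
    refine ⟨huv.1, ?_⟩
    apply eq_of_scale_eq hqZ
    rw [scale_add, hw']
    have := huv.2
    rw [← sub_eq_zero] at this ⊢
    rw [← this]; abel
  · rw [Nat.le_zero, card_eq_zero, filter_eq_empty_iff]
    intro uv _ heq
    apply hdiv
    intro j
    have := congr_fun heq j
    simp only [Pi.add_apply, scale] at this
    refine ⟨psvR k h k uv.1 j - psvR k h k uv.2 j, ?_⟩
    linear_combination -this

/-- **`W(q) ≤ #{(x,y) : congruences} · J_{m,k,h}(ℬ_q)`.** [cite: Ford2002, proof of Lemma 4.1 (case S₄)] -/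
theorem Wcount_le_card_mul (hq : q ≠ 0) :
    Wcount k h t m B q Bq ≤ ((X1 t B q ×ˢ X1 t B q).filter fun xy =>
        ∀ j : Fin k, ((q : ℤ) ^ (j.val + 1)) ∣ psvR k h k xy.2 j - psvR k h k xy.1 j).card
      * Jinc k m Bq h k := by
  classical
  unfold Wcount
  rw [card_filter, sum_product, sum_product]
  simp_rw [sum_product]
  -- reorder: `∑_x ∑_u ∑_y ∑_v = ∑_x ∑_y ∑_u ∑_v`
  have hre : ∀ x ∈ X1 t B q, ∑ u ∈ tuples m Bq, ∑ y ∈ X1 t B q, ∑ v ∈ tuples m Bq,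
      (if psvR k h k x + scale (q : ℤ) (psvR k h k u) = psvR k h k y + scale (q : ℤ) (psvR k h k v)
        then 1 else 0)
      = ∑ y ∈ X1 t B q, (((tuples m Bq ×ˢ tuples m Bq).filter fun uv =>
          psvR k h k x + scale (q : ℤ) (psvR k h k uv.1)
            = psvR k h k y + scale (q : ℤ) (psvR k h k uv.2)).card) := by
    intro x _
    rw [sum_comm]
    refine sum_congr rfl fun y _ => ?_
    rw [card_filter, sum_product]
  rw [sum_congr rfl hre, card_filter, sum_product, sum_mul]
  refine sum_le_sum fun x hx => ?_
  rw [sum_mul]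
  refine sum_le_sum fun y hy => ?_
  refine (card_uv_fiber_le hq x y).trans ?_
  split_ifs <;> simp

/-- **`W(q) ≤ |ℬ^t| (k^t)^{N₁} J_{m,k,h}(ℬ_q)`** when the prime factors of `q` exceed `k`,
`ω(q) ≤ N₁`, and the heads have coordinates in `[1, P]` with `P < q^h`.
[cite: Ford2002, proof of Lemma 4.1 ("W(q) ≤ k^{2t(1+1/(rη))} q^{…} |𝒞(P,R)|^t J_{s-t,k,h}(𝒞(P/q,R))")] -/
theorem Wcount_le (hh : 1 ≤ h) (hk : h + t = k + 1) (hq : q ≠ 0) (hqk : ∀ p ∈ q.primeFactors, k < p)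
    {N₁ : ℕ} (hω : q.primeFactors.card ≤ N₁) {P : ℝ} (hPq : P < (q : ℝ) ^ h)
    (hB : ∀ z ∈ B, 1 ≤ z ∧ (z : ℝ) ≤ P) :
    Wcount k h t m B q Bq ≤ (tuples t B).card * (k ^ t) ^ N₁ * Jinc k m Bq h k := by
  classical
  refine (Wcount_le_card_mul hq).trans (Nat.mul_le_mul_right _ ?_)
  -- `#{(x,y)} = ∑_y #{x}` and each fibre `≤ (k^t)^{ω(q)}`
  rw [card_filter, sum_product_right]
  have hkt : 1 ≤ k ^ t := by
    rcases Nat.eq_zero_or_pos t with h0 | hpos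
    · subst h0; simp
    · exact Nat.one_le_pow _ _ (by omega)
  calc ∑ y ∈ X1 t B q, ∑ x ∈ X1 t B q,
        (if ∀ j : Fin k, ((q : ℤ) ^ (j.val + 1)) ∣ psvR k h k (x, y).2 j - psvR k h k (x, y).1 j then 1 else 0)
      ≤ ∑ _y ∈ X1 t B q, (k ^ t) ^ N₁ := by
        refine sum_le_sum fun y hy => ?_
        rw [← card_filter]
        refine le_trans ?_ (Nat.pow_le_pow_right hkt hω)
        refine card_cong_le hh hk hq hqk hPq _ (fun x hx i => ?_) (fun x hx => ?_) (psv k y) (fun x hx j hj => ?_)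
        · rw [mem_filter, X1, mem_filter, tuplesInj, mem_filter] at hx
          exact hB _ ((mem_tuples.1 hx.1.1.1) i)
        · rw [mem_filter, X1, mem_filter] at hx; exact hx.1.2
        · rw [mem_filter] at hx
          have hd := hx.2 j
          simp only [psvR, hj, true_and] at hd
          have hjk : j.val + 1 ≤ k := j.2
          simp only [hjk, if_true] at hd
          have h1 : ((q : ℤ) ^ h) ∣ (q : ℤ) ^ (j.val + 1) := pow_dvd_pow _ hj
          have := h1.trans hd
          rw [← dvd_neg]; convert this using 1; ring
    _ ≤ (tuples t B).card * (k ^ t) ^ N₁ := by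
        rw [sum_const, smul_eq_mul]
        refine Nat.mul_le_mul_right _ (card_le_card ?_)
        intro x hx; rw [X1, mem_filter, tuplesInj, mem_filter] at hx; exact hx.1.1

end W

end FordVK
end Literature.NumberTheory.LFunctions
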